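import Summits.NavierStokesRegularity.NavierStokesRegularity.Theorems.TypeICertificateLadderNoTypeIBlowupLemma35
import Literature.Analysis.FluidPDE.ClassicalSuitable
import Literature.Analysis.FluidPDE.LocalLeraySolutions
import Literature.Analysis.FluidPDE.PressureMollifiedBound

/-!
# `TypeIConcentration` (stmt-NavierStokesRegularity-2881), line `bp-scaled-energy`: NO `K`-only
# radius exists for the vertex stub, even on finite-data solutions (the sharp quantifier form)

Negative (support) lemma for the crux `TypeICertificateLadder.TypeIConcentration` (drefute seat,
generation 2; one public theorem, private helpers, no definitions), completing the sibling files
`VertexStubGauge.lean` / `VertexStubParasitic.lean` (cdisprove, generation 4).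

The registered stub of the lead's picked line, `stub_scaledEnergyVertexEventually` — LANDED as
`Theorems.stub_scaledEnergyVertexEventually` (p76070) and composed into the proof of the crux
(`Theorems/TypeICertificateLadderTypeIConcentration.lean`) — reads
`∀ K, ∃ d(K), ∀ M' ≠ ⊤, ∃ r₁(K, M') ∈ (0, 1/4], ∀ (v, q, G)` Type-I(`K`) suitable weak in `Q(0,1)`
with data `A(0,3/4) + E(0,3/4) + D(0,1) ≤ M'`, `∀ r ∈ (0, r₁)`, `A + E + C + D ≤ d`. The siblings
refute (i) the DATA-FREE RANGE form `∃ d ∃ r₁ ∀ (v,q,G)` with the data hypothesis dropped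
(`vertexStub_false_of_dataFreeRange[_gauge]`) and (ii) the ALL-SCALES form
`∃ d ∀ M' ≠ ⊤ … ∀ r < 1/4` (`vertexStub_false_allScales[_gauge]`). This file refutes the form lying
BETWEEN the stub and both of those — the only one a planner might still hope for:

  (iii) UNIFORM RADIUS: `∃ d ∃ r₁ ∈ (0, 1/4] ∀ M' ≠ ⊤ ∀ (v,q,G)`, data `≤ M'` KEPT, `∀ r ∈ (0, r₁)`.

Since (i) ⇒ (iii) (ignore the data hypothesis) and (ii) ⇒ (iii) (take `r₁ = 1/4`), `¬(iii)`
(`vertexStub_false_uniformRadius_gauge`, every level `K ≥ 0`) implies both sibling theorems;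
(iii) is exactly "the quantifiers `∀ M' ∃ r₁` of the stub may be swapped", i.e. "some range of
scales depends on `K` only, at least for solutions with FINITE unit-scale data". Witness: the rest
state with the constant pressure gauge `(v, q, G) = (0, N, 0)` — a suitable weak solution on any
region (smooth pair, every term of the system vanishes, `∇N = 0`; tree
`isSuitableWeakSolutionOn_of_contDiffOn`), Type-I at every `K ≥ 0`, `A = E = C = 0`, and
`D(0, r; N) = r⁻² |N|^{3/2} |Q(0,r)|` EXPLICITLY (no mean is subtracted in Seregin–Šverák's `D`):
finite at the unit scale for each `N`, unbounded in `N` at the fixed scale `r₁/2` chosen before `N`.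
(The same six-line argument with `VertexStubParasitic`'s regularised parasitic flow gives the
`C`-term version for `K > 0`, insensitive to pressure normalisation; the gauge version already
covers every level.) Helpers are `private` copies (the sibling `VertexStubGauge` proves close
variants under other names), so this module adds exactly one name to the namespace.

MORAL, sharpest form: in Lemma 3.5's contraction `ℰ(ϑr) ≤ ½ℰ(r) + B(K)` only the limit level
`d(K)` is data-free; the number of halvings, hence `r₁`, is a genuine function of `M'` with
`r₁(K, M') ↓ 0` as `M' ↑ ∞` — for finite-data solutions too. Do not file "K-only scale" variants
of the stub, of `uniformMorrey_of_rate`'s `r₀`, or of item 2884's `r₀`.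
[cite: SereginSverak2009, Lemma 3.5 and its proof (arXiv:0804.1803 pp. 9–10)]
-/

noncomputable section

set_option linter.dupNamespace false

namespace Summit.NavierStokesRegularity.NavierStokesRegularity.Theorems.TypeIConcentration.Negative

open MeasureTheory Set Function Filter Topology TopologicalSpace Metric
open Literature.Analysis.FluidPDE Literature.Analysis.FluidPDE.SereginSverak2009
open scoped NNReal ENNReal Laplacian

local notation "ℝ³" => EuclideanSpace ℝ (Fin 3)

/-- The rest state with a constant pressure `(0, N)` is a suitable weak solution of the unforced
Navier–Stokes system on every open space–time region, for every viscosity (smooth classical pair,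
every term of the momentum equation vanishes). [cite: CaffarelliKohnNirenberg1982, §2 (2.1)–(2.5)] -/
private theorem urg_isSuitableWeakSolutionOn_zero_const (Q : Opens (ℝ × ℝ³)) (ν N : ℝ) :
    IsSuitableWeakSolutionOn Q ν 0 (0 : ℝ → ℝ³ → ℝ³) (fun (_ : ℝ) (_ : ℝ³) => N) := by
  have hQ : (Q : Set (ℝ × ℝ³)) ⊆ (univ : Set ℝ) ×ˢ (univ : Set ℝ³) :=
    fun z _ => ⟨mem_univ _, mem_univ _⟩
  have hu0 : uncurry (0 : ℝ → ℝ³ → ℝ³) = fun _ => 0 := rfl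
  have hp0 : uncurry (fun (_ : ℝ) (_ : ℝ³) => N) = fun _ => N := rfl
  refine isSuitableWeakSolutionOn_of_contDiffOn (S := univ) isOpen_univ hQ ?_ ?_ ?_ ?_ ?_
  · rw [hu0]; exact contDiffOn_const
  · rw [hp0]; exact contDiffOn_const
  · rw [hu0]; exact continuousOn_const
  · intro t _ x
    have h1 : timeDeriv (0 : ℝ → ℝ³ → ℝ³) t x = 0 := by simp [timeDeriv]
    have h2 : convect ((0 : ℝ → ℝ³ → ℝ³) t) ((0 : ℝ → ℝ³ → ℝ³) t) x = 0 := by simp [convect]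
    have h3 : (Δ ((0 : ℝ → ℝ³ → ℝ³) t)) x = 0 := by simp [Pi.zero_def]
    have h4 : gradient (fun _ : ℝ³ => N) x = 0 := gradient_fun_const x N
    rw [h1, h2, h3, h4]
    simp
  · intro t _ x
    simp [VectorCalculus.divergence]

/-- `D(0, r; N) = r⁻² · |N|^{3/2} · |Q(0, r)|` for a constant pressure.
[cite: SereginSverak2009, §3 (definition of D, arXiv p. 9)] -/
private theorem urg_pressureD_const (N r : ℝ) :
    pressureD 0 r (fun (_ : ℝ) (_ : ℝ³) => N) =
      (ENNReal.ofReal r ^ 2)⁻¹ * (‖N‖ₑ ^ (3 / 2 : ℝ) * volume (parCyl (0 : ℝ × ℝ³) r)) := by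
  unfold pressureD
  rw [setLIntegral_const]

/-- `Q(0, r)`, `r > 0`, has positive volume (open, contains `(-r²/2, 0)`). [folklore] -/
private theorem urg_volume_parCyl_pos {r : ℝ} (hr : 0 < r) : 0 < volume (parCyl (0 : ℝ × ℝ³) r) := by
  refine (isOpen_parCyl 0 r).measure_pos volume ⟨((-r ^ 2 / 2 : ℝ), (0 : ℝ³)), ?_⟩
  rw [mem_parCyl_zero]
  have hr2 : 0 < r ^ 2 := by positivity
  refine ⟨⟨by simp only; linarith, by simp only; linarith⟩, ?_, ?_⟩
  · have : cylRadius (0 : ℝ³) = 0 := by simp [cylRadius]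
    simp only [this, hr]
  · simpa using hr

/-- At a fixed scale `r > 0` the pressure functional of the constant gauge exceeds any finite
level: `∃ N ≥ 0, D(0, r; N) > d`. [folklore] -/
private theorem urg_exists_pressureD_const_gt {d : ℝ≥0∞} (hd : d ≠ ⊤) {r : ℝ} (hr : 0 < r) :
    ∃ N : ℝ, 0 ≤ N ∧ d < pressureD 0 r (fun (_ : ℝ) (_ : ℝ³) => N) := by
  set κ : ℝ≥0∞ := (ENNReal.ofReal r ^ 2)⁻¹ * volume (parCyl (0 : ℝ × ℝ³) r) with hκ
  have hr2 : ENNReal.ofReal r ^ 2 ≠ 0 := pow_ne_zero _ (ENNReal.ofReal_pos.2 hr).ne'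
  have hr2' : ENNReal.ofReal r ^ 2 ≠ ⊤ := ENNReal.pow_ne_top ENNReal.ofReal_ne_top
  have hκ0 : κ ≠ 0 := mul_ne_zero (ENNReal.inv_ne_zero.2 hr2') (urg_volume_parCyl_pos hr).ne'
  have hκtop : κ ≠ ⊤ :=
    ENNReal.mul_ne_top (ENNReal.inv_ne_top.2 hr2) (isBounded_parCyl 0 r).measure_lt_top.ne
  set x : ℝ≥0∞ := (d + 1) / κ with hx
  have hd1 : d + 1 ≠ ⊤ := ENNReal.add_ne_top.2 ⟨hd, ENNReal.one_ne_top⟩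
  have hxtop : x ≠ ⊤ := ENNReal.div_ne_top hd1 hκ0
  have hN0 : 0 ≤ x.toReal + 1 := by positivity
  refine ⟨x.toReal + 1, hN0, ?_⟩
  rw [urg_pressureD_const]
  have h1 : x ≤ ‖x.toReal + 1‖ₑ := by
    rw [Real.enorm_eq_ofReal hN0]
    calc x = ENNReal.ofReal x.toReal := (ENNReal.ofReal_toReal hxtop).symm
      _ ≤ ENNReal.ofReal (x.toReal + 1) := ENNReal.ofReal_le_ofReal (by linarith)
  have h2 : ‖x.toReal + 1‖ₑ ≤ ‖x.toReal + 1‖ₑ ^ (3 / 2 : ℝ) := by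
    have h1le : 1 ≤ ‖x.toReal + 1‖ₑ := by
      rw [Real.enorm_eq_ofReal hN0, ← ENNReal.ofReal_one]
      exact ENNReal.ofReal_le_ofReal (by linarith [ENNReal.toReal_nonneg (a := x)])
    calc ‖x.toReal + 1‖ₑ = ‖x.toReal + 1‖ₑ ^ (1 : ℝ) := (ENNReal.rpow_one _).symm
      _ ≤ ‖x.toReal + 1‖ₑ ^ (3 / 2 : ℝ) := ENNReal.rpow_le_rpow_of_exponent_le h1le (by norm_num)
  calc d < d + 1 := ENNReal.lt_add_right hd one_ne_zero
    _ = x * κ := (ENNReal.div_mul_cancel hκ0 hκtop).symm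
    _ ≤ ‖x.toReal + 1‖ₑ ^ (3 / 2 : ℝ) * κ := mul_le_mul' (h1.trans h2) le_rfl
    _ = (ENNReal.ofReal r ^ 2)⁻¹ * (‖x.toReal + 1‖ₑ ^ (3 / 2 : ℝ) * volume (parCyl (0 : ℝ × ℝ³) r)) := by
        rw [hκ]; ring

/-- The unit-scale data of the witness are finite: `A(0,3/4;0) + E(0,3/4;0) + D(0,1;N) ≠ ∞`.
[folklore] -/
private theorem urg_data_ne_top (N : ℝ) :
    energyA 0 (3 / 4) (0 : ℝ → ℝ³ → ℝ³) +
      dissipationE 0 (3 / 4) (0 : ℝ → ℝ³ → ℝ³ →L[ℝ] ℝ³) +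
      pressureD 0 1 (fun (_ : ℝ) (_ : ℝ³) => N) ≠ ⊤ := by
  have hA : energyA 0 (3 / 4) (0 : ℝ → ℝ³ → ℝ³) = 0 :=
    le_antisymm (essSup_le_of_ae_le 0 (Eventually.of_forall fun t => by simp)) zero_le
  have hE : dissipationE 0 (3 / 4) (0 : ℝ → ℝ³ → ℝ³ →L[ℝ] ℝ³) = 0 := by
    unfold dissipationE
    simp [frobeniusNormSq_zero]
  rw [hA, hE, zero_add, zero_add, urg_pressureD_const]
  refine ENNReal.mul_ne_top (ENNReal.inv_ne_top.2 (by simp)) (ENNReal.mul_ne_top ?_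
    (isBounded_parCyl 0 1).measure_lt_top.ne)
  exact ENNReal.rpow_ne_top_of_nonneg (by norm_num) enorm_ne_top

/-- **No `K`-only radius (every level `K ≥ 0`).** The uniform-radius strengthening
`∃ d ∃ r₁ ∀ M' ≠ ⊤` of the landed stub `stub_scaledEnergyVertexEventually` — data hypothesis KEPT —
is FALSE: given `d, r₁`, the rest state with the constant pressure gauge `N` (chosen after `r₁`,
`urg_exists_pressureD_const_gt`) is a Type-I(`K`) suitable weak solution in `Q(0,1)` admissible at
its own FINITE data level `M' := A(0,3/4;0) + E(0,3/4;0) + D(0,1;N)`, yet `D(0, r₁/2; N) > d`. This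
implies the siblings' `vertexStub_false_of_dataFreeRange_gauge` (drop the data hypothesis) and
`vertexStub_false_allScales_gauge` (`r₁ = 1/4`): the quantifier order `∀ M' ∃ r₁` of the stub cannot
be swapped even on finite-data solutions. [cite: SereginSverak2009, Lemma 3.5 (arXiv:0804.1803 pp. 9–10)] -/
theorem vertexStub_false_uniformRadius_gauge {K : ℝ} (hK : 0 ≤ K) :
    ¬ ∃ d : ℝ≥0, ∃ r₁ : ℝ, 0 < r₁ ∧ r₁ ≤ 1 / 4 ∧ ∀ M' : ℝ≥0∞, M' ≠ ⊤ →
      ∀ (v : ℝ → EuclideanSpace ℝ (Fin 3) → EuclideanSpace ℝ (Fin 3))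
        (q : ℝ → EuclideanSpace ℝ (Fin 3) → ℝ)
        (G : ℝ → EuclideanSpace ℝ (Fin 3) → EuclideanSpace ℝ (Fin 3) →L[ℝ] EuclideanSpace ℝ (Fin 3)),
        IsSuitableWeakSolutionOn (parCylOpens 0 1) 1 0 v q →
        (∫⁻ z in parCyl 0 1, ‖v z.1 z.2‖ₑ ^ (3 : ℕ) < ∞) →
        HasWeakSpatialGradientOn (parCylOpens 0 1) v G →
        (∀ᵐ z ∂(volume.restrict (parCyl 0 1)), Real.sqrt (-z.1) * ‖v z.1 z.2‖ ≤ K) →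
        energyA 0 (3 / 4) v + dissipationE 0 (3 / 4) G + pressureD 0 1 q ≤ M' →
        ∀ r ∈ Ioo (0 : ℝ) r₁,
          energyA 0 r v + dissipationE 0 r G + cubicC 0 r v + pressureD 0 r q ≤ d := by
  rintro ⟨d, r₁, hr₁, -, h⟩
  have hr : r₁ / 2 ∈ Ioo (0 : ℝ) r₁ := ⟨by positivity, by linarith⟩
  obtain ⟨N, -, hN⟩ := urg_exists_pressureD_const_gt (d := (d : ℝ≥0∞)) ENNReal.coe_ne_top hr.1
  have hL3 : ∫⁻ z in parCyl (0 : ℝ × ℝ³) 1, ‖(0 : ℝ → ℝ³ → ℝ³) z.1 z.2‖ₑ ^ (3 : ℕ) < ∞ := by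
    simp
  have hrate : ∀ᵐ z ∂(volume.restrict (parCyl (0 : ℝ × ℝ³) 1)),
      Real.sqrt (-z.1) * ‖(0 : ℝ → ℝ³ → ℝ³) z.1 z.2‖ ≤ K :=
    Eventually.of_forall fun z => by simpa using hK
  have hle := h _ (urg_data_ne_top N) 0 (fun _ _ => N) 0
    (urg_isSuitableWeakSolutionOn_zero_const _ 1 N) hL3 (hasWeakSpatialGradientOn_zero _) hrate le_rfl
    (r₁ / 2) hr
  exact absurd (le_trans (le_add_left le_rfl) hle) (not_le.2 hN)

end Summit.NavierStokesRegularity.NavierStokesRegularity.Theorems.TypeIConcentration.Negative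

end
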